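import Summits.RiemannHypothesis.RiemannHypothesis.Theorems.HandoffDipoleChebyshev
import Summits.RiemannHypothesis.RiemannHypothesis.Theorems.HandoffChebyshevMellin
import Summits.RiemannHypothesis.RiemannHypothesis.Theorems.HandoffBottomCriterion
import Summits.RiemannHypothesis.RiemannHypothesis.Theorems.HandoffLandauPole
import Literature.NumberTheory.LFunctions.WeilMellinInversion
import HarnessLib

/-!
# HANDOFF — LEMMA L in the kernel: an off-line zero makes the Weil window bottom unbounded below (cell rh-explicit, TRACK «HANDOFF», seat theory-2; file B)

HONEST FRAMING. Nothing here is a step towards RH: the theorem runs FROM `¬RH` TO negativity. It discharges theory-1's typed open lemma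
`WeilBottomDropOfOffLineZero` (`HandoffBottomCriterion.lean`, HANDOFF-STATEMENT §J.4) by idea-1's PRIME-SIDE argument (WEIL-BOTTOM-UNBOUNDED.md §2,
checked by theory-1; idea-2's L10′ is the zero-side twin). Division of labour (INBOX 06:20Z/06:35Z): files A1/A2 (`HandoffBumpAutocorr.lean`, `HandoffDipoleChebyshev.lean`, this seat)
bounds the smoothed `n^{−1/2}`-weighted Chebyshev sum `F(x) = Σ_n Λ(n)n^{−1/2}φ(log n − log x)` by `K₀ + P(√x + 1/√x)` (`P = φ̂(1)`) beyond `x = e^{2r}`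
whenever the window bottom `ε` is bounded below; file B1 (`HandoffChebyshevMellin.lean`, this seat) shows that `F` is a measurable, locally finite
sum with `|F(x)| ≤ C₀x²` and `∫₁^∞ F x^{−(s+1)} dx = Φ(s)L(Λ, s+½)` (`Φ(s) = φ̂(s+½)` entire); THIS file computes the Mellin transform of the
comparison function `g = K₀ + P(√x + 1/√x) − F` on `Re s > 3`: `K₀/s + P/(s−½) + P/(s+½) + Φ(s)·ζ′/ζ(s+½)` with `Φ(½) = P` (§2,
`L(Λ, s) = −ζ′/ζ(s)`), derives `g ≥ 0` beyond `e^{2r}` and `g·x^{−4} ∈ L¹(1, ∞)` from a bounded bottom (§3), shows `Φ(ρ₀ − ½) ≠ 0` for a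
narrow bump (§4), and feeds prove-1's generic Landau–pole endgame (`HandoffLandauPole.false_of_mellin_eq_logDerivZeta`: Landau's lemma on the
Mellin side, MV2007 Lemma 15.1, and the blow-up at a right-most zero, NicolasOmega pattern) with the right-most zero on the line of the given one
(prove-1's `exists_rightmost_zero_of_offline_zero`) (§5): `exists_weilGroundEnergy_lt_of_zero` = `WeilBottomDropOfOffLineZero` unfolded. TREE STATUS (theory-1 gen4 06:29Z): the
statement is ALREADY a kernel theorem by the ZERO side (`SoloInformedQuasiWeilExact.riemannHypothesis_iff_weilGroundEnergy_bddBelow`; theory-1's bridge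
`HandoffBottomDischarge.lean`) — this file is an independent SECOND proof by the PRIME side, and the only consumer of `HandoffLandauPole.lean`.

References: H. L. Montgomery, R. C. Vaughan, Multiplicative Number Theory I (2007) §15.1 Lemma 15.1, Thm 15.2 (`MontgomeryVaughan2007`);
E. Bombieri, Rend. Mat. Acc. Lincei (9) 11 (2000) §4 (`Bombieri2000Weil`).
-/

set_option linter.dupNamespace false  -- the mandated namespace repeats `RiemannHypothesis`

noncomputable section

open Set Filter Complex MeasureTheory Topology Literature.NumberTheory.LFunctions
open Literature.NumberTheory.LFunctions.Landau
open Literature.Analysis.SpecialFunctions (reDigammaQuarter)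
open Summit.RiemannHypothesis.RiemannHypothesis.Theorems.HandoffCapSharp (integral_bump_sq_pos)
open Summit.RiemannHypothesis.RiemannHypothesis.Theorems.HandoffBumpAutocorr
open Summit.RiemannHypothesis.RiemannHypothesis.Theorems.HandoffDipoleChebyshev
open Summit.RiemannHypothesis.RiemannHypothesis.Theorems.HandoffChebyshevMellin
open Summit.RiemannHypothesis.RiemannHypothesis.Theorems.HandoffDecomposition
open scoped Real ComplexConjugate ArithmeticFunction.vonMangoldt

namespace Summit.RiemannHypothesis.RiemannHypothesis.Theorems.HandoffBottomDropProof

variable (ψ : ContDiffBump (0 : ℝ))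

/-! ## §2  The Mellin transform of the comparison function -/

/-- `Φ` is entire. [folklore] -/
theorem differentiable_Phi : Differentiable ℂ (fun s : ℂ ↦ weilMellin (weilConv (fun x : ℝ ↦ ((ψ x : ℝ) : ℂ)) (weilReflect fun x : ℝ
      ↦ ((ψ x : ℝ) : ℂ))) (s + 1 / 2)) := by
  have hφ := isWeilTest_autocorr ψ
  show Differentiable ℂ (weilMellin (weilConv (fun x : ℝ ↦ ((ψ x : ℝ) : ℂ)) (weilReflect fun x : ℝ ↦ ((ψ x : ℝ) : ℂ))) ∘ fun z : ℂ ↦ z + 1 / 2)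
  exact Differentiable.comp (fun s ↦ (hasDerivAt_weilMellin hφ.1.continuous hφ.2 s).differentiableAt)
    (differentiable_id.add_const _)

/-- `Φ(½) = P` (the transform of the real, even `φ` at `1` is real). [folklore] -/
theorem Phi_half : (fun s : ℂ ↦ weilMellin (weilConv (fun x : ℝ ↦ ((ψ x : ℝ) : ℂ)) (weilReflect fun x : ℝ ↦ ((ψ x : ℝ) : ℂ))) (s + 1
      / 2)) (1 / 2) = ((weilMellin (weilConv (fun x : ℝ ↦ ((ψ x : ℝ) : ℂ)) (weilReflect fun x : ℝ ↦ ((ψ x : ℝ) : ℂ))) 1).re : ℂ) :=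
      by
  show weilMellin (weilConv (fun x : ℝ ↦ ((ψ x : ℝ) : ℂ)) (weilReflect fun x : ℝ ↦ ((ψ x : ℝ) : ℂ))) (1 / 2 + 1 / 2) = _
  rw [show (1 / 2 : ℂ) + 1 / 2 = 1 by norm_num]
  refine (Complex.conj_eq_iff_re.1 ?_).symm
  unfold weilMellin
  rw [← integral_conj]
  congr 1 with t
  rw [map_mul, conj_autocorr, ← Complex.exp_conj, map_mul, Complex.conj_ofReal, map_sub, map_one]
  congr 3
  rw [map_div₀, map_one, map_ofNat]

/-- `F(x)·x^{−(s+1)}` is integrable on `(1, ∞)` for `Re s > 2` (`|F| ≤ C₀x²`). [folklore] -/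
theorem integrableOn_F_mul_cpow {s : ℂ} (hs : 2 < s.re) :
    IntegrableOn (fun x : ℝ ↦ (((fun x : ℝ ↦ ∑' n : ℕ, (Λ n : ℝ) / Real.sqrt n * (∫ u : ℝ, ψ u * ψ (u - (Real.log n - Real.log x))))
          x : ℝ) : ℂ) * (x : ℂ) ^ (-(s + 1))) (Ioi 1) := by
  refine Integrable.mono' ((integrableOn_Ioi_rpow_of_lt (show 1 - s.re < -1 by linarith) one_pos).const_mul
    (4 * Real.exp (4 * ψ.rOut) * ∫ u, ψ u)) ?_ ?_
  · exact ((Complex.measurable_ofReal.comp (measurable_F ψ)).mul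
      (Complex.measurable_ofReal.pow_const _)).aestronglyMeasurable
  · rw [ae_restrict_iff' measurableSet_Ioi]
    refine Eventually.of_forall fun x (hx : 1 < x) ↦ ?_
    have hx0 : 0 < x := by linarith
    rw [norm_mul, Complex.norm_real, Complex.norm_cpow_eq_rpow_re_of_pos hx0, Real.norm_eq_abs,
      show (-(s + 1)).re = -(s.re + 1) by simp]
    have h1 := abs_F_le ψ hx.le
    have h2 : x ^ (-(s.re + 1)) = x ^ (1 - s.re) * (x ^ 2)⁻¹ := by
      rw [← Real.rpow_natCast x 2, ← Real.rpow_neg hx0.le, ← Real.rpow_add hx0]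
      congr 1
      push_cast
      ring
    rw [h2]
    calc |(fun x : ℝ ↦ ∑' n : ℕ, (Λ n : ℝ) / Real.sqrt n * (∫ u : ℝ, ψ u * ψ (u - (Real.log n - Real.log x)))) x| * (x ^ (1 - s.re)
          * (x ^ 2)⁻¹) = |(fun x : ℝ ↦ ∑' n : ℕ, (Λ n : ℝ) / Real.sqrt n * (∫ u : ℝ, ψ u * ψ (u - (Real.log n - Real.log x)))) x| /
          x ^ 2 * x ^ (1 - s.re) := by ring
      _ ≤ 4 * Real.exp (4 * ψ.rOut) * (∫ u, ψ u) * x ^ (1 - s.re) := by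
          refine mul_le_mul_of_nonneg_right ?_ (Real.rpow_nonneg hx0.le _)
          rw [div_le_iff₀ (by positivity)]
          exact h1

/-- **The Mellin transform of the comparison function** `g = K₀ + P(√x + 1/√x) − F` on `Re s > 3`:
`K₀/s + P/(s−½) + P/(s+½) + Φ(s)·ζ′/ζ(s+½)` (`L(Λ, s+½) = −ζ′/ζ(s+½)`, Mathlib). [cite: MontgomeryVaughan2007, §15.1 (proof of Thm 15.2)] -/
theorem mellinIoi_comparison (hr : ψ.rOut < Real.log 2 / 4) (K₀ : ℝ) {s : ℂ} (hs : 3 < s.re) :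
    mellinIoi (fun x ↦ K₀ + (weilMellin (weilConv (fun x : ℝ ↦ ((ψ x : ℝ) : ℂ)) (weilReflect fun x : ℝ ↦ ((ψ x : ℝ) : ℂ))) 1).re *
          (Real.sqrt x + (Real.sqrt x)⁻¹) - (fun x : ℝ ↦ ∑' n : ℕ, (Λ n : ℝ) / Real.sqrt n * (∫ u : ℝ, ψ u * ψ (u - (Real.log n -
          Real.log x)))) x) s =
      (K₀ : ℂ) / s + ((weilMellin (weilConv (fun x : ℝ ↦ ((ψ x : ℝ) : ℂ)) (weilReflect fun x : ℝ ↦ ((ψ x : ℝ) : ℂ))) 1).re : ℂ) / (s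
            - 1 / 2) + ((weilMellin (weilConv (fun x : ℝ ↦ ((ψ x : ℝ) : ℂ)) (weilReflect fun x : ℝ ↦ ((ψ x : ℝ) : ℂ))) 1).re : ℂ) /
            (s + 1 / 2) +
        (fun s : ℂ ↦ weilMellin (weilConv (fun x : ℝ ↦ ((ψ x : ℝ) : ℂ)) (weilReflect fun x : ℝ ↦ ((ψ x : ℝ) : ℂ))) (s + 1 / 2)) s *
              (deriv riemannZeta (s + 1 / 2) / riemannZeta (s + 1 / 2)) := by
  have hs0 : 0 < s.re := by linarith
  have i0 : IntegrableOn (fun x : ℝ ↦ (x : ℂ) ^ (-(s + 1))) (Ioi 1) :=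
    integrableOn_Ioi_cpow_of_lt (by simp; linarith) one_pos
  have i1 := HandoffChebyshevMellin.integrableOn_sqrt_mul_cpow (s := s) (by linarith)
  have i2 := integrableOn_inv_sqrt_mul_cpow (s := s) hs0
  have i3 := integrableOn_F_mul_cpow ψ (s := s) (by linarith)
  have e : EqOn (fun x : ℝ ↦ ((K₀ + (weilMellin (weilConv (fun x : ℝ ↦ ((ψ x : ℝ) : ℂ)) (weilReflect fun x : ℝ ↦ ((ψ x : ℝ) : ℂ)))
        1).re * (Real.sqrt x + (Real.sqrt x)⁻¹) - (fun x : ℝ ↦ ∑' n : ℕ, (Λ n : ℝ) / Real.sqrt n * (∫ u : ℝ, ψ u * ψ (u - (Real.log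
        n - Real.log x)))) x : ℝ) : ℂ) *
      (x : ℂ) ^ (-(s + 1)))
      (fun x : ℝ ↦ (K₀ : ℂ) * (x : ℂ) ^ (-(s + 1)) +
        (((weilMellin (weilConv (fun x : ℝ ↦ ((ψ x : ℝ) : ℂ)) (weilReflect fun x : ℝ ↦ ((ψ x : ℝ) : ℂ))) 1).re : ℂ) * (((Real.sqrt x
              : ℝ) : ℂ) * (x : ℂ) ^ (-(s + 1))) +
          ((weilMellin (weilConv (fun x : ℝ ↦ ((ψ x : ℝ) : ℂ)) (weilReflect fun x : ℝ ↦ ((ψ x : ℝ) : ℂ))) 1).re : ℂ) * ((((Real.sqrt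
                x)⁻¹ : ℝ) : ℂ) * (x : ℂ) ^ (-(s + 1)))) -
        (((fun x : ℝ ↦ ∑' n : ℕ, (Λ n : ℝ) / Real.sqrt n * (∫ u : ℝ, ψ u * ψ (u - (Real.log n - Real.log x)))) x : ℝ) : ℂ) * (x : ℂ)
              ^ (-(s + 1))) (Ioi 1) := by
    intro x _
    simp only [Complex.ofReal_add, Complex.ofReal_sub, Complex.ofReal_mul, Complex.ofReal_inv]
    ring
  have hF : ∫ x in Ioi (1 : ℝ), (((fun x : ℝ ↦ ∑' n : ℕ, (Λ n : ℝ) / Real.sqrt n * (∫ u : ℝ, ψ u * ψ (u - (Real.log n - Real.log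
        x)))) x : ℝ) : ℂ) * (x : ℂ) ^ (-(s + 1)) =
      (fun s : ℂ ↦ weilMellin (weilConv (fun x : ℝ ↦ ((ψ x : ℝ) : ℂ)) (weilReflect fun x : ℝ ↦ ((ψ x : ℝ) : ℂ))) (s + 1 / 2)) s *
            LSeries (fun n ↦ (Λ n : ℂ)) (s + 1 / 2) := mellinIoi_F ψ hr (by linarith)
  have iA : Integrable (fun x : ℝ ↦ (K₀ : ℂ) * (x : ℂ) ^ (-(s + 1))) (volume.restrict (Ioi 1)) := i0.const_mul _
  have iB : Integrable (fun x : ℝ ↦ ((weilMellin (weilConv (fun x : ℝ ↦ ((ψ x : ℝ) : ℂ)) (weilReflect fun x : ℝ ↦ ((ψ x : ℝ) : ℂ)))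
        1).re : ℂ) * (((Real.sqrt x : ℝ) : ℂ) * (x : ℂ) ^ (-(s + 1))))
      (volume.restrict (Ioi 1)) := i1.const_mul _
  have iC : Integrable (fun x : ℝ ↦ ((weilMellin (weilConv (fun x : ℝ ↦ ((ψ x : ℝ) : ℂ)) (weilReflect fun x : ℝ ↦ ((ψ x : ℝ) : ℂ)))
        1).re : ℂ) * ((((Real.sqrt x)⁻¹ : ℝ) : ℂ) * (x : ℂ) ^ (-(s + 1))))
      (volume.restrict (Ioi 1)) := i2.const_mul _
  have iBC : Integrable (fun x : ℝ ↦ ((weilMellin (weilConv (fun x : ℝ ↦ ((ψ x : ℝ) : ℂ)) (weilReflect fun x : ℝ ↦ ((ψ x : ℝ) : ℂ)))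
        1).re : ℂ) * (((Real.sqrt x : ℝ) : ℂ) * (x : ℂ) ^ (-(s + 1))) +
      ((weilMellin (weilConv (fun x : ℝ ↦ ((ψ x : ℝ) : ℂ)) (weilReflect fun x : ℝ ↦ ((ψ x : ℝ) : ℂ))) 1).re : ℂ) * ((((Real.sqrt
            x)⁻¹ : ℝ) : ℂ) * (x : ℂ) ^ (-(s + 1)))) (volume.restrict (Ioi 1)) :=
    iB.add iC
  have iABC : Integrable (fun x : ℝ ↦ (K₀ : ℂ) * (x : ℂ) ^ (-(s + 1)) +
      (((weilMellin (weilConv (fun x : ℝ ↦ ((ψ x : ℝ) : ℂ)) (weilReflect fun x : ℝ ↦ ((ψ x : ℝ) : ℂ))) 1).re : ℂ) * (((Real.sqrt x :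
            ℝ) : ℂ) * (x : ℂ) ^ (-(s + 1))) +
        ((weilMellin (weilConv (fun x : ℝ ↦ ((ψ x : ℝ) : ℂ)) (weilReflect fun x : ℝ ↦ ((ψ x : ℝ) : ℂ))) 1).re : ℂ) * ((((Real.sqrt
              x)⁻¹ : ℝ) : ℂ) * (x : ℂ) ^ (-(s + 1))))) (volume.restrict (Ioi 1)) :=
    iA.add iBC
  unfold mellinIoi
  rw [setIntegral_congr_fun measurableSet_Ioi e, integral_sub iABC i3, integral_add iA iBC, integral_add iB iC,
    integral_const_mul, integral_const_mul, integral_const_mul, integral_Ioi_cpow_eq hs0,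
    integral_Ioi_sqrt_mul_cpow (by linarith), integral_Ioi_inv_sqrt_mul_cpow hs0, hF,
    ArithmeticFunction.LSeries_vonMangoldt_eq_deriv_riemannZeta_div (by simp; linarith)]
  ring

/-! ## §3  From a bounded bottom to an eventually non-negative, polynomially bounded comparison function -/

/-- **File A's interface, read at `L = log x`**: if `−C ≤ ε(t)` for all `t > 0` then, with the explicit constant
`K₀ = C·∫ψ² + Re Q(ψ) + C_A(ψ)`, `0 ≤ K₀ + P(√x + 1/√x) − F(x)` for every `x > e^{2r}`. [folklore] -/
theorem comparison_nonneg {C : ℝ} (hC : ∀ t : ℝ, 0 < t → -C ≤ weilGroundEnergy t) :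
    ∃ K₀ : ℝ, ∀ x : ℝ, Real.exp (2 * ψ.rOut) < x →
      0 ≤ K₀ + (weilMellin (weilConv (fun x : ℝ ↦ ((ψ x : ℝ) : ℂ)) (weilReflect fun x : ℝ ↦ ((ψ x : ℝ) : ℂ))) 1).re * (Real.sqrt x +
            (Real.sqrt x)⁻¹) - (fun x : ℝ ↦ ∑' n : ℕ, (Λ n : ℝ) / Real.sqrt n * (∫ u : ℝ, ψ u * ψ (u - (Real.log n - Real.log x))))
            x := by
  refine ⟨C * (∫ y : ℝ, ψ y ^ 2) + (weilQuadratic (fun x : ℝ ↦ ((ψ x : ℝ) : ℂ))).re + 1 / (2 * π) * ∫ t : ℝ, ‖weilMellin (fun x : ℝ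
        ↦ ((ψ x : ℝ) : ℂ)) (1 / 2 + t * I)‖ ^ 2 *
      (reDigammaQuarter t + 2 * |reDigammaQuarter 0|), fun x hx ↦ ?_⟩
  have hx0 : 0 < x := lt_trans (Real.exp_pos _) hx
  have hL : 2 * ψ.rOut < Real.log x := (Real.lt_log_iff_exp_lt hx0).2 hx
  have hmain := weilGroundEnergy_mul_le_dipole ψ hL
  have hε : -C * ∫ y : ℝ, ψ y ^ 2 ≤ weilGroundEnergy (Real.log x / 2 + ψ.rOut) * ∫ y : ℝ, ψ y ^ 2 :=
    mul_le_mul_of_nonneg_right (hC _ (by linarith [ψ.rOut_pos])) (integral_bump_sq_pos ψ).le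
  have h1 : Real.exp (Real.log x / 2) = Real.sqrt x := by
    rw [Real.sqrt_eq_rpow, Real.rpow_def_of_pos hx0]
    ring_nf
  have h2 : Real.exp (-(Real.log x / 2)) = (Real.sqrt x)⁻¹ := by rw [Real.exp_neg, h1]
  rw [re_tsum_eq_F ψ, Real.exp_log hx0, h1, h2] at hmain
  have h3 := hε.trans hmain
  rw [neg_mul, mul_comm (Real.sqrt x + (Real.sqrt x)⁻¹)] at h3
  linarith

/-- The comparison function is measurable. [folklore] -/
theorem measurable_comparison (K₀ : ℝ) :
    Measurable fun x : ℝ ↦ K₀ + (weilMellin (weilConv (fun x : ℝ ↦ ((ψ x : ℝ) : ℂ)) (weilReflect fun x : ℝ ↦ ((ψ x : ℝ) : ℂ))) 1).re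
          * (Real.sqrt x + (Real.sqrt x)⁻¹) - (fun x : ℝ ↦ ∑' n : ℕ, (Λ n : ℝ) / Real.sqrt n * (∫ u : ℝ, ψ u * ψ (u - (Real.log n -
          Real.log x)))) x :=
  (measurable_const.add (measurable_const.mul
    (Real.continuous_sqrt.measurable.add Real.continuous_sqrt.measurable.inv))).sub (measurable_F ψ)

/-- `g(x)·x^{−4}` is integrable on `(1, ∞)` (`|g| ≤ (|K₀| + 2|P| + C₀)x²`). [folklore] -/
theorem integrableOn_comparison (K₀ : ℝ) :
    IntegrableOn (fun x : ℝ ↦ (K₀ + (weilMellin (weilConv (fun x : ℝ ↦ ((ψ x : ℝ) : ℂ)) (weilReflect fun x : ℝ ↦ ((ψ x : ℝ) : ℂ)))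
          1).re * (Real.sqrt x + (Real.sqrt x)⁻¹) - (fun x : ℝ ↦ ∑' n : ℕ, (Λ n : ℝ) / Real.sqrt n * (∫ u : ℝ, ψ u * ψ (u -
          (Real.log n - Real.log x)))) x) *
      x ^ (-((3 : ℝ) + 1))) (Ioi 1) := by
  set P : ℝ := (weilMellin (weilConv (fun x : ℝ ↦ ((ψ x : ℝ) : ℂ)) (weilReflect fun x : ℝ ↦ ((ψ x : ℝ) : ℂ))) 1).re with hP
  set C₀ : ℝ := 4 * Real.exp (4 * ψ.rOut) * ∫ u, ψ u with hC₀
  have hC₀0 : 0 ≤ C₀ := by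
    have : 0 ≤ ∫ u, ψ u := integral_nonneg fun _ ↦ ψ.nonneg
    positivity
  refine Integrable.mono' ((integrableOn_Ioi_rpow_of_lt (by norm_num : (-2 : ℝ) < -1) one_pos).const_mul
    (|K₀| + 2 * |P| + C₀)) ?_ ?_
  · exact ((measurable_comparison ψ K₀).mul (measurable_id.pow_const _)).aestronglyMeasurable
  · rw [ae_restrict_iff' measurableSet_Ioi]
    refine Eventually.of_forall fun x (hx : 1 < x) ↦ ?_
    have hx0 : 0 < x := by linarith
    have hs1 : 1 ≤ Real.sqrt x := Real.one_le_sqrt.2 hx.le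
    have hsx : Real.sqrt x ≤ x ^ 2 := by nlinarith [Real.sq_sqrt hx0.le, Real.sqrt_nonneg x]
    have hsi : (Real.sqrt x)⁻¹ ≤ x ^ 2 := (inv_le_one_of_one_le₀ hs1).trans (by nlinarith)
    have hsi0 : 0 < (Real.sqrt x)⁻¹ := inv_pos.2 (by linarith)
    have hF := abs_F_le ψ hx.le
    have hg : |K₀ + P * (Real.sqrt x + (Real.sqrt x)⁻¹) - (fun x : ℝ ↦ ∑' n : ℕ, (Λ n : ℝ) / Real.sqrt n * (∫ u : ℝ, ψ u * ψ (u -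
          (Real.log n - Real.log x)))) x| ≤ (|K₀| + 2 * |P| + C₀) * x ^ 2 := by
      rw [abs_le]
      constructor
      · nlinarith [le_abs_self K₀, neg_abs_le K₀, le_abs_self P, neg_abs_le P, (abs_le.1 hF).1, (abs_le.1 hF).2,
          abs_nonneg P, abs_nonneg K₀]
      · nlinarith [le_abs_self K₀, neg_abs_le K₀, le_abs_self P, neg_abs_le P, (abs_le.1 hF).1, (abs_le.1 hF).2,
          abs_nonneg P, abs_nonneg K₀]
    have h4 : x ^ (-((3 : ℝ) + 1)) = x ^ (-2 : ℝ) * (x ^ 2)⁻¹ := by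
      rw [← Real.rpow_natCast x 2, ← Real.rpow_neg hx0.le, ← Real.rpow_add hx0]
      norm_num
    rw [norm_mul, Real.norm_eq_abs, Real.norm_eq_abs, abs_of_pos (Real.rpow_pos_of_pos hx0 _), h4]
    calc |K₀ + P * (Real.sqrt x + (Real.sqrt x)⁻¹) - (fun x : ℝ ↦ ∑' n : ℕ, (Λ n : ℝ) / Real.sqrt n * (∫ u : ℝ, ψ u * ψ (u -
          (Real.log n - Real.log x)))) x| * (x ^ (-2 : ℝ) * (x ^ 2)⁻¹)
        = |K₀ + P * (Real.sqrt x + (Real.sqrt x)⁻¹) - (fun x : ℝ ↦ ∑' n : ℕ, (Λ n : ℝ) / Real.sqrt n * (∫ u : ℝ, ψ u * ψ (u -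
              (Real.log n - Real.log x)))) x| / x ^ 2 * x ^ (-2 : ℝ) := by ring
      _ ≤ (|K₀| + 2 * |P| + C₀) * x ^ (-2 : ℝ) := by
          refine mul_le_mul_of_nonneg_right ?_ (Real.rpow_nonneg hx0.le _)
          rw [div_le_iff₀ (by positivity)]
          exact hg

/-! ## §4  `Φ(ρ₀ − ½) ≠ 0` for a narrow bump -/

/-- `Φ(0) = ∫ φ = ∫ |φ|` (`φ = φ_r ≥ 0`). [folklore] -/
theorem Phi_zero : (fun s : ℂ ↦ weilMellin (weilConv (fun x : ℝ ↦ ((ψ x : ℝ) : ℂ)) (weilReflect fun x : ℝ ↦ ((ψ x : ℝ) : ℂ))) (s + 1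
      / 2)) 0 = ((∫ t : ℝ, ‖(weilConv (fun x : ℝ ↦ ((ψ x : ℝ) : ℂ)) (weilReflect fun x : ℝ ↦ ((ψ x : ℝ) : ℂ))) t‖ : ℝ) : ℂ) := by
  show weilMellin (weilConv (fun x : ℝ ↦ ((ψ x : ℝ) : ℂ)) (weilReflect fun x : ℝ ↦ ((ψ x : ℝ) : ℂ))) (0 + 1 / 2) = _
  unfold weilMellin
  rw [← integral_complex_ofReal]
  congr 1 with t
  rw [show ((0 : ℂ) + 1 / 2 - 1 / 2) = 0 by ring, zero_mul, Complex.exp_zero, mul_one, autocorr_eq,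
    Complex.norm_real, Real.norm_of_nonneg (HandoffChebyshevMellin.autocorr_nonneg ψ t)]

/-- `∫ |φ| = (∫ψ)² > 0`. [folklore] -/
theorem integral_norm_autocorr_pos : 0 < ∫ t : ℝ, ‖(weilConv (fun x : ℝ ↦ ((ψ x : ℝ) : ℂ)) (weilReflect fun x : ℝ ↦ ((ψ x : ℝ) : ℂ))) t‖ := by
  have h1 : ‖(fun s : ℂ ↦ weilMellin (weilConv (fun x : ℝ ↦ ((ψ x : ℝ) : ℂ)) (weilReflect fun x : ℝ ↦ ((ψ x : ℝ) : ℂ))) (s + 1 / 2))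
        0‖ = ‖weilMellin (fun x : ℝ ↦ ((ψ x : ℝ) : ℂ)) (1 / 2 + (0 : ℝ) * I)‖ ^ 2 := by
    rw [← norm_weilMellin_autocorr_half ψ 0]
    simp
  have h2 : weilMellin (fun x : ℝ ↦ ((ψ x : ℝ) : ℂ)) (1 / 2 + (0 : ℝ) * I) = ((∫ t, ψ t : ℝ) : ℂ) := by
    unfold weilMellin
    rw [← integral_complex_ofReal]
    congr 1 with t
    simp
  rw [Phi_zero, h2, Complex.norm_real, Complex.norm_real, Real.norm_of_nonneg (integral_nonneg fun t ↦ norm_nonneg _),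
    Real.norm_of_nonneg (integral_nonneg fun t ↦ ψ.nonneg)] at h1
  rw [h1]
  exact pow_pos ψ.integral_pos 2

/-- **`Φ(s₁) ≠ 0` when `4r|s₁| < 1`**: `|Φ(s₁) − Φ(0)| ≤ ∫|φ(t)||e^{s₁t} − 1| ≤ 4r|s₁|·Φ(0) < Φ(0)` (`|t| ≤ 2r` on the support,
`|e^w − 1| ≤ 2|w|` for `|w| ≤ 1`). [folklore] -/
theorem Phi_ne_zero {s₁ : ℂ} (hr : 4 * ψ.rOut * ‖s₁‖ < 1) : (fun s : ℂ ↦ weilMellin (weilConv (fun x : ℝ ↦ ((ψ x : ℝ) : ℂ))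
      (weilReflect fun x : ℝ ↦ ((ψ x : ℝ) : ℂ))) (s + 1 / 2)) s₁ ≠ 0 := by
  have hφt := isWeilTest_autocorr ψ
  have hcont : Continuous (weilConv (fun x : ℝ ↦ ((ψ x : ℝ) : ℂ)) (weilReflect fun x : ℝ ↦ ((ψ x : ℝ) : ℂ))) := hφt.1.continuous
  have hint : Integrable (weilConv (fun x : ℝ ↦ ((ψ x : ℝ) : ℂ)) (weilReflect fun x : ℝ ↦ ((ψ x : ℝ) : ℂ))) :=
        hcont.integrable_of_hasCompactSupport hφt.2
  have hc0 := integral_norm_autocorr_pos ψ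
  have hdiff : (fun s : ℂ ↦ weilMellin (weilConv (fun x : ℝ ↦ ((ψ x : ℝ) : ℂ)) (weilReflect fun x : ℝ ↦ ((ψ x : ℝ) : ℂ))) (s + 1 /
        2)) s₁ - (fun s : ℂ ↦ weilMellin (weilConv (fun x : ℝ ↦ ((ψ x : ℝ) : ℂ)) (weilReflect fun x : ℝ ↦ ((ψ x : ℝ) : ℂ))) (s + 1 /
        2)) 0 = ∫ t : ℝ, (weilConv (fun x : ℝ ↦ ((ψ x : ℝ) : ℂ)) (weilReflect fun x : ℝ ↦ ((ψ x : ℝ) : ℂ))) t * (cexp (s₁ * t) - 1)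
        := by
    show weilMellin (weilConv (fun x : ℝ ↦ ((ψ x : ℝ) : ℂ)) (weilReflect fun x : ℝ ↦ ((ψ x : ℝ) : ℂ))) (s₁ + 1 / 2) - weilMellin
          (weilConv (fun x : ℝ ↦ ((ψ x : ℝ) : ℂ)) (weilReflect fun x : ℝ ↦ ((ψ x : ℝ) : ℂ))) (0 + 1 / 2) = _
    unfold weilMellin
    rw [← integral_sub (integrable_weilIntegrand hcont hφt.2 _) (integrable_weilIntegrand hcont hφt.2 _)]
    congr 1 with t
    rw [show (s₁ + 1 / 2 - 1 / 2 : ℂ) = s₁ by ring, show ((0 : ℂ) + 1 / 2 - 1 / 2) = 0 by ring, zero_mul,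
      Complex.exp_zero]
    ring
  have hbound : ∀ t : ℝ, ‖(weilConv (fun x : ℝ ↦ ((ψ x : ℝ) : ℂ)) (weilReflect fun x : ℝ ↦ ((ψ x : ℝ) : ℂ))) t * (cexp (s₁ * t) -
        1)‖ ≤ ‖(weilConv (fun x : ℝ ↦ ((ψ x : ℝ) : ℂ)) (weilReflect fun x : ℝ ↦ ((ψ x : ℝ) : ℂ))) t‖ * (4 * ψ.rOut * ‖s₁‖) := by
    intro t
    rw [norm_mul]
    rcases le_or_gt |t| (2 * ψ.rOut) with ht | ht
    · refine mul_le_mul_of_nonneg_left ?_ (norm_nonneg _)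
      have h1 : ‖s₁ * (t : ℂ)‖ ≤ 2 * ψ.rOut * ‖s₁‖ := by
        rw [norm_mul, Complex.norm_real, Real.norm_eq_abs]
        calc ‖s₁‖ * |t| ≤ ‖s₁‖ * (2 * ψ.rOut) := mul_le_mul_of_nonneg_left ht (norm_nonneg _)
          _ = 2 * ψ.rOut * ‖s₁‖ := by ring
      calc ‖cexp (s₁ * t) - 1‖ ≤ 2 * ‖s₁ * (t : ℂ)‖ := Complex.norm_exp_sub_one_le (by linarith)
        _ ≤ 4 * ψ.rOut * ‖s₁‖ := by linarith
    · rw [HandoffBumpAutocorr.autocorr_eq_zero ψ ht]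
      simp
  have hle : ‖(fun s : ℂ ↦ weilMellin (weilConv (fun x : ℝ ↦ ((ψ x : ℝ) : ℂ)) (weilReflect fun x : ℝ ↦ ((ψ x : ℝ) : ℂ))) (s + 1 /
        2)) s₁ - (fun s : ℂ ↦ weilMellin (weilConv (fun x : ℝ ↦ ((ψ x : ℝ) : ℂ)) (weilReflect fun x : ℝ ↦ ((ψ x : ℝ) : ℂ))) (s + 1 /
        2)) 0‖ ≤ (∫ t : ℝ, ‖(weilConv (fun x : ℝ ↦ ((ψ x : ℝ) : ℂ)) (weilReflect fun x : ℝ ↦ ((ψ x : ℝ) : ℂ))) t‖) * (4 * ψ.rOut *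
        ‖s₁‖) := by
    rw [hdiff, ← integral_mul_const]
    exact norm_integral_le_of_norm_le (hint.norm.mul_const _) (Eventually.of_forall hbound)
  intro h0
  rw [h0, zero_sub, norm_neg, Phi_zero, Complex.norm_real, Real.norm_of_nonneg hc0.le] at hle
  nlinarith

/-! ## §5  The theorem -/

/-- **LEMMA L by the PRIME SIDE (idea-1 gen5 §2), kernel version = theory-1's `WeilBottomDropOfOffLineZero` UNFOLDED: an off-line zero
makes the Weil window bottom unbounded below** — every zero of `ζ` with `½ < Re ρ < 1` and every `C` admit `t > 0` with `ε(t) < −C`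
(prove-1's Landau–pole endgame `false_of_mellin_eq_logDerivZeta`, `HandoffLandauPole.lean`, fed with §2–§4 at the right-most zero on the line
of `ρ`, `exists_rightmost_zero_of_offline_zero`). SECOND PROOF: the named Prop itself is already proved in the tree by the ZERO side
(theory-1's bridge `HandoffDecomposition.weilBottomDropOfOffLineZero_holds`, `HandoffBottomDischarge.lean`, from
`SoloInformedQuasiWeilExact.riemannHypothesis_iff_weilGroundEnergy_bddBelow`), so it is not restated here (the gate dedups by statement);
this theorem is its body, reached through Landau's lemma on the smoothed Chebyshev sum (no explicit formula, no zero sum).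
[cite: MontgomeryVaughan2007, §15.1 Thm 15.2 (method); this track] -/
theorem exists_weilGroundEnergy_lt_of_zero {ρ : ℂ} (hρ : riemannZeta ρ = 0) (h1 : 1 / 2 < ρ.re) (h2 : ρ.re < 1) (C : ℝ) :
    ∃ t : ℝ, 0 < t ∧ weilGroundEnergy t < -C := by
  by_contra hcon
  push Not at hcon
  obtain ⟨ρ₀, h0, hρ, _, hray⟩ := exists_rightmost_zero_of_offline_zero hρ h1 h2
  -- the bump: radius `r = 1/(8(|ρ₀ − ½| + 2))`
  set r : ℝ := 1 / (8 * (‖ρ₀ - 1 / 2‖ + 2)) with hr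
  have hn0 : 0 ≤ ‖ρ₀ - 1 / 2‖ := norm_nonneg _
  have hr0 : 0 < r := by positivity
  obtain ⟨ψ₀, hψ⟩ : ∃ ψ₀ : ContDiffBump (0 : ℝ), ψ₀.rOut = r := ⟨⟨r / 2, r, by positivity, by linarith⟩, rfl⟩
  have hr16 : r ≤ 1 / 16 := one_div_le_one_div_of_le (by norm_num) (by linarith)
  have hr1 : ψ₀.rOut < Real.log 2 / 4 := by
    rw [hψ]; linarith [Real.log_two_gt_d9]
  have hr2 : 4 * ψ₀.rOut * ‖ρ₀ - 1 / 2‖ < 1 := by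
    rw [hψ, hr]
    rw [show 4 * (1 / (8 * (‖ρ₀ - 1 / 2‖ + 2))) * ‖ρ₀ - 1 / 2‖ = ‖ρ₀ - 1 / 2‖ / (2 * (‖ρ₀ - 1 / 2‖ + 2)) by
      field_simp; ring]
    rw [div_lt_one (by positivity)]
    linarith
  obtain ⟨K₀, hK₀⟩ := comparison_nonneg ψ₀ hcon
  exact false_of_mellin_eq_logDerivZeta (K := (K₀ : ℂ))
    (M := ((weilMellin (weilConv (fun x : ℝ ↦ ((ψ₀ x : ℝ) : ℂ)) (weilReflect fun x : ℝ ↦ ((ψ₀ x : ℝ) : ℂ))) 1).re : ℂ))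
    (Φt := fun s : ℂ ↦ weilMellin (weilConv (fun x : ℝ ↦ ((ψ₀ x : ℝ) : ℂ)) (weilReflect fun x : ℝ ↦ ((ψ₀ x : ℝ) : ℂ)))
      (s + 1 / 2))
    (measurable_comparison ψ₀ K₀) (by norm_num : (1 : ℝ) / 2 ≤ 3) (integrableOn_comparison ψ₀ K₀)
    (Real.one_le_exp (by linarith [ψ₀.rOut_pos])) hK₀ (differentiable_Phi ψ₀) (Phi_half ψ₀)
    (fun s hs ↦ mellinIoi_comparison ψ₀ hr1 K₀ hs) h0 hρ hray (Phi_ne_zero ψ₀ hr2)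

end Summit.RiemannHypothesis.RiemannHypothesis.Theorems.HandoffBottomDropProof

end
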